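import Summits.KontsevichZagierPeriods.KontsevichZagierPeriods.Theorems.RootDecompWalshStrataHtypeConics

/-!
# Root decomposition (Walsh strata), part 52b — H-type fibre discriminants VI′: conic sections assembled

`R-HC ⟸ R-HLx ∧ R-HCx` (`InBaker.of_Hconics`).  A section of the vertex chart over a conic edge
`H − m y² = (q₀ + q₁ x + q₂ y)²` of an H-type cell satisfies `((m + q₂²) y + q₂ ℓ(ζ))² = Δ(ζ)`; it is covered
(Tarski–Seidenberg, rule (1)) by the four pieces `{Δ(ζ) > 0, ±((m + q₂²) y + q₂ ℓ) > 0, ±(q₁ g − e q₀ ζ) > 0}`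
— each a branch `y = Y_{±1}(ζ)` pulled back to the `x`-line by `InBaker.of_Hconic_piece` (part 52) —, the
level set `{Δ(ζ) > 0, q₁ g − e q₀ ζ = 0}` (a constant section with `ℚ`-rational integrand, a finite set, or
empty), and `{Δ(ζ) ≤ 0} = {Δ(ζ) = 0}`: a finite set when `Δ ≢ 0` (`ζ` is then injective on it), and a LINE
section `(m + q₂²) y + q₂ ℓ = 0` — `R-HLx` via `InBaker.of_Hlines` (part 51b) — when `Δ ≡ 0`.

References: [KontsevichZagier2001 §1.2 rules (1)–(3)], [BCR1998 §2.2].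
-/

noncomputable section

open Set MeasureTheory MvPolynomial Literature.NumberTheory.Transcendental
open Literature.ModelTheory.ExponentialFields (IsSemialgebraic isSemialgebraic_univ isSemialgebraic_empty)
open Summit.KontsevichZagierPeriods.RootDecompWalshStrata.ConicDescent.VertexChart

namespace Summit.KontsevichZagierPeriods.RootDecompWalshStrata.ConicDescent.BallCube

/-! #### 52.3 `R-HC` from `R-HLx` and `R-HCx` -/

/-- **Conic sections reduced to one variable.**  A section of the vertex chart lying over a conic edge of an
H-type cell decomposes (Tarski–Seidenberg) into: the four branch/sign pieces of 52.2 (each in the Baker sector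
once `R-HCx` is), the part where `q₁ g − e q₀ ζ = 0` and `Δ(ζ) > 0` (a rational constant section or a finite
set), and the part where `Δ(ζ) ≤ 0`, i.e. `Δ(ζ) = 0` — a finite set when `Δ ≢ 0`, and a LINE section
(`(m + q₂²) y + q₂ ℓ = 0`, handled by `R-HLx`, part 51) when `Δ ≡ 0`.
[KontsevichZagier2001 §1.2 rules (1)–(3); BCR1998 §2.2; this node] -/
theorem InBaker.of_Hconics
    (hX : (∀ (e g m γ k0 k1 : ℚ), 0 < e → 1 ≤ m →
      ∀ (S : Set (Fin 1 → ℝ)), IsSemialgebraic ℚ S →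
        (∀ t ∈ S, (0 ≤ t 0 ∧ t 0 ≤ 1) ∧ 0 < (e : ℝ) * t 0 ^ 2 + g ∧
          (m : ℝ) * ((k0 : ℝ) + k1 * t 0) ^ 2 < (e : ℝ) * t 0 ^ 2 + g) →
        ∀ r : KZ.IntegralRep 1, r.domain = S →
          EqOn r.integrand (fun t => (γ : ℝ) * ((e : ℝ) / 3 * t 0 ^ 3 + g * t 0) *
            √((e : ℝ) * t 0 ^ 2 + g - m * ((k0 : ℝ) + k1 * t 0) ^ 2) *
            (((k1 : ℝ) * g - e * k0 * t 0) / ((e : ℝ) * t 0 ^ 2 + g) ^ 2)) S →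
          InBaker (KZ.of r)))
    (hC : (∀ (e g m γ q0 q1 q2 s : ℚ), 0 < e → 1 ≤ m → (s = 1 ∨ s = -1) →
      ∀ (S : Set (Fin 1 → ℝ)), IsSemialgebraic ℚ S →
        (∀ t ∈ S, (0 ≤ t 0 ∧ t 0 ≤ 1) ∧ 0 < (e : ℝ) * t 0 ^ 2 + g ∧
          0 < ((m : ℝ) + q2 ^ 2) * ((e : ℝ) * t 0 ^ 2 + g) - m * ((q0 : ℝ) + q1 * t 0) ^ 2) →
        ∀ r : KZ.IntegralRep 1, r.domain = S →
          EqOn r.integrand (fun t => (γ : ℝ) * ((e : ℝ) / 3 * t 0 ^ 3 + g * t 0) * ((q1 : ℝ) * g - e * q0 * t 0) *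
            ((m : ℝ) * ((q0 : ℝ) + q1 * t 0) +
              s * q2 * √(((m : ℝ) + q2 ^ 2) * ((e : ℝ) * t 0 ^ 2 + g) - m * ((q0 : ℝ) + q1 * t 0) ^ 2)) ^ 2 /
            (((e : ℝ) * t 0 ^ 2 + g) ^ 2 *
              √(((m : ℝ) + q2 ^ 2) * ((e : ℝ) * t 0 ^ 2 + g) - m * ((q0 : ℝ) + q1 * t 0) ^ 2))) S →
          InBaker (KZ.of r))) :
    (∀ (e g m γ : ℚ), 0 < e → 1 ≤ m → ∀ (Q : Wall),
      ∀ (T : Set (Fin 1 → ℝ)) (ζ : (Fin 1 → ℝ) → ℝ), IsSemialgebraic ℚ T → T ⊆ Icc 0 1 →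
        IsSemialgebraicFunOn ℚ T ζ → ContinuousOn ζ T →
        (∀ b ∈ T, (0 < b 0 ∧ (m : ℝ) * b 0 ^ 2 < 1) ∧ (0 ≤ ζ b ∧ ζ b ≤ 1) ∧
          0 < (e : ℝ) * ζ b ^ 2 + g ∧
          ((e : ℝ) * ζ b ^ 2 + g) * gT m (b 0) ^ 2 =
            (Q.eval (ζ b) (√((e : ℝ) * ζ b ^ 2 + g) * gU m (b 0))) ^ 2) →
        ∀ r : KZ.IntegralRep 1, r.domain = T →
          EqOn r.integrand (fun b => (γ : ℝ) * ((e : ℝ) / 3 * ζ b ^ 3 + g * ζ b) * gW m (b 0)) T →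
          InBaker (KZ.of r)) := by
  classical
  intro e g m γ he hm Q T ζ hT hTI hζ hζc hF r hrd hri
  obtain ⟨q0, q1, q2⟩ := Q
  have hm0 : (0 : ℚ) ≤ m := zero_le_one.trans hm
  have he' : (0 : ℝ) < e := by exact_mod_cast he
  have hMq : (0 : ℚ) < m + q2 ^ 2 := add_pos_of_pos_of_nonneg (zero_lt_one.trans_le hm) (sq_nonneg _)
  have hM0 : (0 : ℝ) < (m : ℝ) + q2 ^ 2 := by exact_mod_cast hMq
  have hA : ∀ b ∈ T, 0 < Polynomial.aeval (ζ b) (hP e g) := fun b hb => by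
    rw [aeval_hP]; exact (hF b hb).2.2.1
  -- the edge as `((m + q₂²) y + q₂ ℓ(ζ))² = Δ(ζ)`
  have hquad : ∀ b ∈ T,
      (((m : ℝ) + q2 ^ 2) * (vS (hP e g) (ζ b) * gU m (b 0)) + q2 * ((q0 : ℝ) + q1 * ζ b)) ^ 2 =
        Polynomial.aeval (ζ b) (cDp e g m q0 q1 q2) := fun b hb => by
    obtain ⟨-, -, hAp, hw⟩ := hF b hb
    simp only [Wall.eval] at hw
    have hgT2 := gT_sq_add hm0 (b 0)
    have hy2 : (vS (hP e g) (ζ b) * gU m (b 0)) ^ 2 = ((e : ℝ) * ζ b ^ 2 + g) * gU m (b 0) ^ 2 := by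
      rw [mul_pow, vS_sq (hA b hb).le, aeval_hP]
    have hvs : vS (hP e g) (ζ b) = √((e : ℝ) * ζ b ^ 2 + g) := by rw [vS, aeval_hP]
    rw [aeval_cDp]
    rw [hvs] at hy2 ⊢
    linear_combination (-((m : ℝ) + q2 ^ 2)) * hw +
      (((m : ℝ) + q2 ^ 2) * ((e : ℝ) * ζ b ^ 2 + g)) * hgT2 + (((m : ℝ) + q2 ^ 2) * m) * hy2
  -- … so on `± ((m + q₂²) y + q₂ ℓ) > 0` the section is the branch `Y_{±1}`
  have hbranch : ∀ b ∈ T, ∀ s : ℚ, (s = 1 ∨ s = -1) →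
      0 < (s : ℝ) * (((m : ℝ) + q2 ^ 2) * (vS (hP e g) (ζ b) * gU m (b 0)) + q2 * ((q0 : ℝ) + q1 * ζ b)) →
      vS (hP e g) (ζ b) * gU m (b 0) = cY e g m q0 q1 q2 s (ζ b) := fun b hb s hs hsE => by
    have habs : |((m : ℝ) + q2 ^ 2) * (vS (hP e g) (ζ b) * gU m (b 0)) + q2 * ((q0 : ℝ) + q1 * ζ b)| =
        √(Polynomial.aeval (ζ b) (cDp e g m q0 q1 q2)) := by
      rw [← hquad b hb, Real.sqrt_sq_eq_abs]
    have hE : ((m : ℝ) + q2 ^ 2) * (vS (hP e g) (ζ b) * gU m (b 0)) + q2 * ((q0 : ℝ) + q1 * ζ b) =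
        s * √(Polynomial.aeval (ζ b) (cDp e g m q0 q1 q2)) := by
      rcases hs with rfl | rfl
      · rw [Rat.cast_one, one_mul] at hsE ⊢
        rw [← habs, abs_of_pos hsE]
      · rw [Rat.cast_neg, Rat.cast_one] at hsE ⊢
        rw [← habs, abs_of_neg (by linarith), neg_one_mul, neg_neg]
    rw [cY, eq_div_iff hM0.ne', hLam]
    linear_combination hE
  -- semialgebraic ingredients on `T`
  have hAζ : IsSemialgebraicFunOn ℚ T fun b => (e : ℝ) * ζ b ^ 2 + g :=
    (((isSemialgebraicFunOn_ratCast hT e).mul_holds (hζ.mul_holds hζ)).add_holds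
      (isSemialgebraicFunOn_ratCast hT g)).congr fun b _ => by
        simp only [Pi.add_apply, Pi.mul_apply]
        ring
  have hq1 : ∀ b ∈ T, MvPolynomial.aeval b (1 + C m * X 0 ^ 2 : MvPolynomial (Fin 1) ℚ) ≠ 0 := fun b _ => by
    simp only [map_add, map_one, map_mul, map_pow, MvPolynomial.aeval_C, MvPolynomial.aeval_X, eq_ratCast]
    exact (one_add_pos hm0 (b 0)).ne'
  have hY : IsSemialgebraicFunOn ℚ T fun b => vS (hP e g) (ζ b) * gU m (b 0) :=
    ((IsSemialgebraicFunOn.sqrt_holds hAζ).mul_holds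
      (isSemialgebraicFunOn_aeval_div_aeval hT (C 2 * X 0) (1 + C m * X 0 ^ 2) hq1)).congr fun b _ => by
        simp only [Pi.mul_apply, map_add, map_one, map_mul, map_pow, MvPolynomial.aeval_C, MvPolynomial.aeval_X,
          eq_ratCast, vS, aeval_hP, gU]
        push_cast
        try ring
  have hDζ : IsSemialgebraicFunOn ℚ T fun b => Polynomial.aeval (ζ b) (cDp e g m q0 q1 q2) :=
    ((((isSemialgebraicFunOn_ratCast hT ((m + q2 ^ 2) * e - m * q1 ^ 2)).mul_holds (hζ.mul_holds hζ)).add_holds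
      ((isSemialgebraicFunOn_ratCast hT (-(2 * m * q0 * q1))).mul_holds hζ)).add_holds
      (isSemialgebraicFunOn_ratCast hT ((m + q2 ^ 2) * g - m * q0 ^ 2))).congr fun b _ => by
        simp only [Pi.add_apply, Pi.mul_apply, aeval_cDp]
        push_cast
        ring
  have hEζ : IsSemialgebraicFunOn ℚ T fun b =>
      ((m : ℝ) + q2 ^ 2) * (vS (hP e g) (ζ b) * gU m (b 0)) + q2 * ((q0 : ℝ) + q1 * ζ b) :=
    (((isSemialgebraicFunOn_ratCast hT (m + q2 ^ 2)).mul_holds hY).add_holds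
      ((isSemialgebraicFunOn_ratCast hT q2).mul_holds
        ((isSemialgebraicFunOn_ratCast hT q0).add_holds ((isSemialgebraicFunOn_ratCast hT q1).mul_holds hζ)))).congr
      fun b _ => by
        simp only [Pi.add_apply, Pi.mul_apply]
        push_cast
        try ring
  have hsE : ∀ s : ℚ, IsSemialgebraicFunOn ℚ T fun b =>
      (s : ℝ) * (((m : ℝ) + q2 ^ 2) * (vS (hP e g) (ζ b) * gU m (b 0)) + q2 * ((q0 : ℝ) + q1 * ζ b)) :=
    fun s => ((isSemialgebraicFunOn_ratCast hT s).mul_holds hEζ).congr fun _ _ => rfl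
  have hNζ : IsSemialgebraicFunOn ℚ T fun b => hNum e g q0 q1 (ζ b) :=
    (IsSemialgebraicFunOn.sub_holds (isSemialgebraicFunOn_ratCast hT (q1 * g))
      ((isSemialgebraicFunOn_ratCast hT (e * q0)).mul_holds hζ)).congr fun b _ => by
        simp only [hNum, Pi.sub_apply, Pi.mul_apply]
        push_cast
        ring
  have hςN : ∀ ς : ℚ, IsSemialgebraicFunOn ℚ T fun b => (ς : ℝ) * hNum e g q0 q1 (ζ b) :=
    fun ς => ((isSemialgebraicFunOn_ratCast hT ς).mul_holds hNζ).congr fun _ _ => rfl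
  -- the pieces
  have hPsa : ∀ s ς : ℚ, IsSemialgebraic ℚ {b | b ∈ T ∧ 0 < Polynomial.aeval (ζ b) (cDp e g m q0 q1 q2) ∧
      0 < (s : ℝ) * (((m : ℝ) + q2 ^ 2) * (vS (hP e g) (ζ b) * gU m (b 0)) + q2 * ((q0 : ℝ) + q1 * ζ b)) ∧
      0 < (ς : ℝ) * hNum e g q0 q1 (ζ b)} := fun s ς => by
    have h := (IsSemialgebraicFunOn.isSemialgebraic_sep_pos hDζ).inter
      ((IsSemialgebraicFunOn.isSemialgebraic_sep_pos (hsE s)).inter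
        (IsSemialgebraicFunOn.isSemialgebraic_sep_pos (hςN ς)))
    convert h using 1
    ext b
    simp only [mem_setOf_eq, mem_inter_iff]
    tauto
  have hZ₂ : IsSemialgebraic ℚ {b | b ∈ T ∧ 0 < Polynomial.aeval (ζ b) (cDp e g m q0 q1 q2) ∧
      hNum e g q0 q1 (ζ b) = ((0 : ℚ) : ℝ)} := by
    have h := (IsSemialgebraicFunOn.isSemialgebraic_sep_pos hDζ).inter
      (isSemialgebraic_sep_eq hNζ (isSemialgebraicFunOn_ratCast hT 0))
    convert h using 1
    ext b
    simp only [mem_setOf_eq, mem_inter_iff]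
    tauto
  have hnD : IsSemialgebraicFunOn ℚ T fun b => -Polynomial.aeval (ζ b) (cDp e g m q0 q1 q2) :=
    hDζ.neg.congr fun _ _ => rfl
  have hZ₁ : IsSemialgebraic ℚ {b | b ∈ T ∧ 0 ≤ -Polynomial.aeval (ζ b) (cDp e g m q0 q1 q2)} :=
    hnD.isSemialgebraic_sep_nonneg
  -- a branch/sign piece pulls back to `R-HCx`
  have hpiece : ∀ s ς : ℚ, (s = 1 ∨ s = -1) → (ς = 1 ∨ ς = -1) →
      ∀ (T' : Set (Fin 1 → ℝ)) (hT' : IsSemialgebraic ℚ T') (hTr : T' ⊆ r.domain),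
      (∀ b ∈ T', b ∈ T ∧ 0 < Polynomial.aeval (ζ b) (cDp e g m q0 q1 q2) ∧
        0 < (s : ℝ) * (((m : ℝ) + q2 ^ 2) * (vS (hP e g) (ζ b) * gU m (b 0)) + q2 * ((q0 : ℝ) + q1 * ζ b)) ∧
        0 < (ς : ℝ) * hNum e g q0 q1 (ζ b)) →
      InBaker (KZ.of (r.restrict T' hT' hTr)) := fun s ς hs hς T' hT' hTr hTA =>
    InBaker.of_Hconic_piece hC he hm γ hs hς (hζ.mono (fun b hb => (hTA b hb).1) hT')
      (fun b hb => ⟨(hF b (hTA b hb).1).1, (hF b (hTA b hb).1).2.1, hA b (hTA b hb).1, (hTA b hb).2.1,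
        hbranch b (hTA b hb).1 s hs (hTA b hb).2.2.1, (hTA b hb).2.2.2⟩)
      (r.restrict T' hT' hTr) rfl fun b hb => hri (hTA b hb).1
  -- cover
  let A : (Bool × Bool) ⊕ Bool → Set (Fin 1 → ℝ) := fun o =>
    match o with
    | Sum.inl (true, true) => {b | b ∈ T ∧ 0 < Polynomial.aeval (ζ b) (cDp e g m q0 q1 q2) ∧
        0 < ((1 : ℚ) : ℝ) * (((m : ℝ) + q2 ^ 2) * (vS (hP e g) (ζ b) * gU m (b 0)) + q2 * ((q0 : ℝ) + q1 * ζ b)) ∧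
        0 < ((1 : ℚ) : ℝ) * hNum e g q0 q1 (ζ b)}
    | Sum.inl (true, false) => {b | b ∈ T ∧ 0 < Polynomial.aeval (ζ b) (cDp e g m q0 q1 q2) ∧
        0 < ((1 : ℚ) : ℝ) * (((m : ℝ) + q2 ^ 2) * (vS (hP e g) (ζ b) * gU m (b 0)) + q2 * ((q0 : ℝ) + q1 * ζ b)) ∧
        0 < ((-1 : ℚ) : ℝ) * hNum e g q0 q1 (ζ b)}
    | Sum.inl (false, true) => {b | b ∈ T ∧ 0 < Polynomial.aeval (ζ b) (cDp e g m q0 q1 q2) ∧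
        0 < ((-1 : ℚ) : ℝ) * (((m : ℝ) + q2 ^ 2) * (vS (hP e g) (ζ b) * gU m (b 0)) + q2 * ((q0 : ℝ) + q1 * ζ b)) ∧
        0 < ((1 : ℚ) : ℝ) * hNum e g q0 q1 (ζ b)}
    | Sum.inl (false, false) => {b | b ∈ T ∧ 0 < Polynomial.aeval (ζ b) (cDp e g m q0 q1 q2) ∧
        0 < ((-1 : ℚ) : ℝ) * (((m : ℝ) + q2 ^ 2) * (vS (hP e g) (ζ b) * gU m (b 0)) + q2 * ((q0 : ℝ) + q1 * ζ b)) ∧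
        0 < ((-1 : ℚ) : ℝ) * hNum e g q0 q1 (ζ b)}
    | Sum.inr true => {b | b ∈ T ∧ 0 < Polynomial.aeval (ζ b) (cDp e g m q0 q1 q2) ∧
        hNum e g q0 q1 (ζ b) = ((0 : ℚ) : ℝ)}
    | Sum.inr false => {b | b ∈ T ∧ 0 ≤ -Polynomial.aeval (ζ b) (cDp e g m q0 q1 q2)}
  have hAs : ∀ o, IsSemialgebraic ℚ (A o) := by
    rintro (⟨_ | _, _ | _⟩ | (_ | _))
    · exact hPsa (-1) (-1)
    · exact hPsa (-1) 1
    · exact hPsa 1 (-1)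
    · exact hPsa 1 1
    · exact hZ₁
    · exact hZ₂
  have hcov : r.domain ⊆ ⋃ o, A o := by
    intro b hb
    have hbT : b ∈ T := hrd ▸ hb
    by_cases hD : 0 < Polynomial.aeval (ζ b) (cDp e g m q0 q1 q2)
    · rcases lt_trichotomy (hNum e g q0 q1 (ζ b)) 0 with hN | hN | hN
      · rcases lt_trichotomy
          (((m : ℝ) + q2 ^ 2) * (vS (hP e g) (ζ b) * gU m (b 0)) + q2 * ((q0 : ℝ) + q1 * ζ b)) 0 with hE | hE | hE
        · exact mem_iUnion.2 ⟨Sum.inl (false, false), hbT, hD,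
            by rw [Rat.cast_neg, Rat.cast_one]; linarith, by rw [Rat.cast_neg, Rat.cast_one]; linarith⟩
        · exfalso
          have hq := hquad b hbT
          rw [hE] at hq
          norm_num at hq
          linarith
        · exact mem_iUnion.2 ⟨Sum.inl (true, false), hbT, hD,
            by rw [Rat.cast_one, one_mul]; exact hE, by rw [Rat.cast_neg, Rat.cast_one]; linarith⟩
      · exact mem_iUnion.2 ⟨Sum.inr true, hbT, hD, by rw [hN, Rat.cast_zero]⟩
      · rcases lt_trichotomy
          (((m : ℝ) + q2 ^ 2) * (vS (hP e g) (ζ b) * gU m (b 0)) + q2 * ((q0 : ℝ) + q1 * ζ b)) 0 with hE | hE | hE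
        · exact mem_iUnion.2 ⟨Sum.inl (false, true), hbT, hD,
            by rw [Rat.cast_neg, Rat.cast_one]; linarith, by rw [Rat.cast_one, one_mul]; exact hN⟩
        · exfalso
          have hq := hquad b hbT
          rw [hE] at hq
          norm_num at hq
          linarith
        · exact mem_iUnion.2 ⟨Sum.inl (true, true), hbT, hD,
            by rw [Rat.cast_one, one_mul]; exact hE, by rw [Rat.cast_one, one_mul]; exact hN⟩
    · exact mem_iUnion.2 ⟨Sum.inr false, hbT, by linarith [not_lt.1 hD]⟩
  refine InBaker.of_cover' r A hAs hcov ?_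
  rintro (⟨_ | _, _ | _⟩ | (_ | _)) T' hT' hTr hTA
  · exact hpiece (-1) (-1) (Or.inr rfl) (Or.inr rfl) T' hT' hTr fun b hb => hTA hb
  · exact hpiece (-1) 1 (Or.inr rfl) (Or.inl rfl) T' hT' hTr fun b hb => hTA hb
  · exact hpiece 1 (-1) (Or.inl rfl) (Or.inr rfl) T' hT' hTr fun b hb => hTA hb
  · exact hpiece 1 1 (Or.inl rfl) (Or.inl rfl) T' hT' hTr fun b hb => hTA hb
  · -- `Δ(ζ) ≤ 0`, hence `Δ(ζ) = 0` and `(m + q₂²) y + q₂ ℓ(ζ) = 0`, on the piece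
    have hD0 : ∀ b ∈ T', Polynomial.aeval (ζ b) (cDp e g m q0 q1 q2) = 0 := fun b hb => by
      have hle : Polynomial.aeval (ζ b) (cDp e g m q0 q1 q2) ≤ 0 := by have h := (hTA hb).2; linarith
      have hge : 0 ≤ Polynomial.aeval (ζ b) (cDp e g m q0 q1 q2) := by rw [← hquad b (hTA hb).1]; positivity
      exact le_antisymm hle hge
    have hE0 : ∀ b ∈ T',
        ((m : ℝ) + q2 ^ 2) * (vS (hP e g) (ζ b) * gU m (b 0)) + q2 * ((q0 : ℝ) + q1 * ζ b) = 0 := fun b hb => by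
      have h0 := hquad b (hTA hb).1
      rw [hD0 b hb] at h0
      exact (pow_eq_zero_iff two_ne_zero).1 h0
    by_cases hΔ : cDp e g m q0 q1 q2 = 0
    · -- `Δ ≡ 0`: the edge is the LINE `(m + q₂²) y + q₂ ℓ = 0`
      refine InBaker.of_Hlines hX e g m γ he hm ⟨q2 * q0, q2 * q1, m + q2 ^ 2⟩ (by exact hMq.ne') T' ζ hT'
        (fun b hb => hTI (hTA hb).1) (hζ.mono (fun b hb => (hTA hb).1) hT') (hζc.mono fun b hb => (hTA hb).1)
        (fun b hb => ?_) (r.restrict T' hT' hTr) rfl fun b hb => hri (hTA hb).1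
      have hbT := (hTA hb).1
      refine ⟨(hF b hbT).1, (hF b hbT).2.1, (hF b hbT).2.2.1, ?_⟩
      have h0 := hE0 b hb
      rw [vS, aeval_hP] at h0
      simp only [Wall.eval]
      push_cast
      linear_combination h0
    · -- `Δ ≢ 0`: `ζ` takes finitely many values and is injective on the piece
      refine InBaker.of_domain_finite _ (finite_of_aeval_root (S := T') (ζ := ζ) (fun b hb b' hb' hbb => ?_) hΔ hD0)
      have h1 := hE0 b hb
      have h2 := hE0 b' hb'
      rw [hbb] at h1
      have hS := vS_pos (hA b' (hTA hb').1)
      have h3 : ((m : ℝ) + q2 ^ 2) * vS (hP e g) (ζ b') * (gU m (b 0) - gU m (b' 0)) = 0 := by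
        linear_combination h1 - h2
      have h4 : gU m (b 0) = gU m (b' 0) := by
        have h5 := (mul_eq_zero.1 h3).resolve_left (mul_ne_zero hM0.ne' hS.ne')
        linarith
      exact funext fun i => by
        rw [Subsingleton.elim i 0]
        exact gU_inj hm0 (hF b (hTA hb).1).1.2 (hF b' (hTA hb').1).1.2 h4
  · -- `q₁ g − e q₀ ζ = 0` and `Δ(ζ) > 0` on the piece
    by_cases hq0 : q0 ≠ 0
    · -- `ζ` is the rational constant `q₁ g/(e q₀)`: rational integrand
      have hq0' : (q0 : ℝ) ≠ 0 := by exact_mod_cast hq0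
      have hx0 : ∀ b ∈ T', ζ b = ((q1 * g / (e * q0) : ℚ) : ℝ) := fun b hb => by
        have h : hNum e g q0 q1 (ζ b) = ((0 : ℚ) : ℝ) := (hTA hb).2.2
        unfold hNum at h
        rw [Rat.cast_zero] at h
        push_cast
        field_simp
        linarith
      have hq3 : ∀ b ∈ (r.restrict T' hT' hTr).domain,
          MvPolynomial.aeval b ((1 + C m * X 0 ^ 2) ^ 3 : MvPolynomial (Fin 1) ℚ) ≠ 0 := fun b _ => by
        simp only [map_pow, map_add, map_one, map_mul, MvPolynomial.aeval_C, MvPolynomial.aeval_X, eq_ratCast]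
        exact pow_ne_zero 3 (one_add_pos hm0 (b 0)).ne'
      refine InBaker.of_eqOn_aeval_div (r.restrict T' hT' hTr)
        (C (γ * (e / 3 * (q1 * g / (e * q0)) ^ 3 + g * (q1 * g / (e * q0))) * 2) * (1 - C m * X 0 ^ 2) ^ 2)
        ((1 + C m * X 0 ^ 2) ^ 3) hq3 fun b hb => ?_
      have hbT' : b ∈ T' := hb
      show r.integrand b = _
      rw [hri (hTA hbT').1]
      dsimp only
      rw [hx0 b hbT', gW]
      simp only [map_mul, map_pow, map_sub, map_add, map_one, MvPolynomial.aeval_C, MvPolynomial.aeval_X,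
        eq_ratCast]
      push_cast
      ring
    · rw [not_not] at hq0
      subst hq0
      by_cases hq1 : q1 = 0
      · -- `q₀ = q₁ = 0`: `(m + q₂²) U_m(v)² = 1` on the piece, a finite set
        subst hq1
        obtain ⟨a, ha⟩ : ∃ a : ℝ, a = (m : ℝ) + q2 ^ 2 := ⟨_, rfl⟩
        obtain ⟨a0, ha0⟩ : ∃ a : ℝ, a = -1 := ⟨_, rfl⟩
        have hp0 : (Polynomial.C a * Polynomial.X ^ 2 + Polynomial.C a0 : Polynomial ℝ) ≠ 0 := fun h0 => by
          have h2 := congrArg (Polynomial.coeff · 2) h0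
          simp at h2
          rw [ha] at h2
          linarith
        refine InBaker.of_domain_finite _ (finite_of_gU_root hm0 (S := T') (fun b hb => (hF b (hTA hb).1).1.2) hp0
          fun b hb => ?_)
        have hbT := (hTA hb).1
        have hq := hquad b hbT
        rw [aeval_cDp] at hq
        push_cast at hq
        have hy2 : (vS (hP e g) (ζ b) * gU m (b 0)) ^ 2 = ((e : ℝ) * ζ b ^ 2 + g) * gU m (b 0) ^ 2 := by
          rw [mul_pow, vS_sq (hA b hbT).le, aeval_hP]
        have hAp : (0 : ℝ) < (e : ℝ) * ζ b ^ 2 + g := (hF b hbT).2.2.1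
        have h1 : (((m : ℝ) + q2 ^ 2) * ((e : ℝ) * ζ b ^ 2 + g)) * (((m : ℝ) + q2 ^ 2) * gU m (b 0) ^ 2 - 1) = 0 := by
          linear_combination hq - ((m : ℝ) + q2 ^ 2) ^ 2 * hy2
        have h2 := (mul_eq_zero.1 h1).resolve_left (mul_ne_zero hM0.ne' hAp.ne')
        simp only [Polynomial.IsRoot.def, Polynomial.eval_add, Polynomial.eval_mul, Polynomial.eval_C,
          Polynomial.eval_pow, Polynomial.eval_X, ha, ha0]
        linear_combination h2
      · by_cases hg0 : g = 0
        · -- `q₀ = 0`, `g = 0`: `U_m(v)` is a root of a fixed non-zero quadratic, a finite set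
          subst hg0
          obtain ⟨a2, ha2⟩ : ∃ a : ℝ, a = ((m : ℝ) + q2 ^ 2) ^ 2 * e := ⟨_, rfl⟩
          obtain ⟨a1, ha1⟩ : ∃ a : ℝ, a = 2 * ((m : ℝ) + q2 ^ 2) * √(e : ℝ) * q2 * q1 := ⟨_, rfl⟩
          obtain ⟨a0, ha0⟩ : ∃ a : ℝ, a = (q2 : ℝ) ^ 2 * q1 ^ 2 - ((m : ℝ) + q2 ^ 2) * e + m * q1 ^ 2 := ⟨_, rfl⟩
          have hp0 : (Polynomial.C a2 * Polynomial.X ^ 2 + Polynomial.C a1 * Polynomial.X + Polynomial.C a0 :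
              Polynomial ℝ) ≠ 0 := fun h0 => by
            have h2 := congrArg (Polynomial.coeff · 2) h0
            simp at h2
            rw [ha2] at h2
            have h3 : (0 : ℝ) < ((m : ℝ) + q2 ^ 2) ^ 2 * e := by positivity
            linarith
          refine InBaker.of_domain_finite _ (finite_of_gU_root hm0 (S := T') (fun b hb => (hF b (hTA hb).1).1.2)
            hp0 fun b hb => ?_)
          have hbT := (hTA hb).1
          have hAp : (0 : ℝ) < (e : ℝ) * ζ b ^ 2 + ((0 : ℚ) : ℝ) := (hF b hbT).2.2.1
          have hz : 0 < ζ b := by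
            rcases (hF b hbT).2.1.1.lt_or_eq with h | h
            · exact h
            · rw [← h, Rat.cast_zero] at hAp; norm_num at hAp
          have hvs : vS (hP e 0) (ζ b) = √(e : ℝ) * ζ b := by
            rw [vS, aeval_hP, Rat.cast_zero, add_zero, Real.sqrt_mul' _ (sq_nonneg _), Real.sqrt_sq hz.le]
          have hse : √(e : ℝ) ^ 2 = e := Real.sq_sqrt he'.le
          have hq := hquad b hbT
          rw [aeval_cDp, hvs] at hq
          push_cast at hq
          have h1 : ζ b ^ 2 * (a2 * gU m (b 0) ^ 2 + a1 * gU m (b 0) + a0) = 0 := by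
            rw [ha2, ha1, ha0]
            linear_combination hq + (-(ζ b ^ 2 * ((m : ℝ) + q2 ^ 2) ^ 2 * gU m (b 0) ^ 2)) * hse
          have h2 := (mul_eq_zero.1 h1).resolve_left (pow_ne_zero 2 hz.ne')
          simp only [Polynomial.IsRoot.def, Polynomial.eval_add, Polynomial.eval_mul, Polynomial.eval_C,
            Polynomial.eval_pow, Polynomial.eval_X]
          exact h2
        · -- `q₀ = 0`, `q₁ g ≠ 0`: the piece is empty
          refine InBaker.of_domain_eq_empty _ (Set.eq_empty_iff_forall_notMem.2 fun b hb => ?_)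
          have h : hNum e g 0 q1 (ζ b) = ((0 : ℚ) : ℝ) := (hTA hb).2.2
          unfold hNum at h
          rw [Rat.cast_zero, mul_zero, zero_mul, sub_zero] at h
          exact mul_ne_zero (by exact_mod_cast hq1 : (q1 : ℝ) ≠ 0) (by exact_mod_cast hg0 : (g : ℝ) ≠ 0) h

end Summit.KontsevichZagierPeriods.RootDecompWalshStrata.ConicDescent.BallCube
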